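import Mathlib.Analysis.Normed.Operator.BoundedLinearMaps
import Mathlib.Topology.VectorBundle.Constructions
import HarnessLib

/-!
# Continuity of fibrewise maps of fibre bundles, read in local trivialisations

Topic `Literature/AlgebraicTopology/CharacteristicClasses`. A map of total spaces
`Ψ : E₁ → E₂` covering a continuous map `g : B₁ → B₂` of the bases and given fibrewise,
`Ψ ⟨b, v⟩ = ⟨g b, Φ_b v⟩`, is continuous at a point as soon as its expression in the local
trivialisations at that point and at its image, `(b, x) ↦ (g b, (e₂ ∘ Ψ ∘ e₁⁻¹)(b, x))`, has a
continuous second component (Husemoller, *Fibre Bundles*, Ch. 2 §5 and Ch. 3 §2: morphisms of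
bundles are checked on charts; Ch. 5 (2.1)–(2.3) for vector bundles "locally `u` has the form
`(b, x) ↦ (b, u_b(x))`"). This is the routine used to build bundle ISOMORPHISMS
(`ComplexVectorBundle.Iso`) between concretely presented bundles (pull-backs, Whitney sums,
`VectorBundleCore`s): Mathlib provides the two halves `Trivialization.continuousAt_of_comp_left`
and `Trivialization.continuousAt_of_comp_right`; this file packages them, and specialises to
bundles presented by a `VectorBundleCore`, where the local expression is explicit in terms of the
coordinate changes.

## Content (all proved)

* `continuousAt_totalSpace_map` — the criterion at a point, for arbitrary fibre bundles.
* `continuous_totalSpace_map` — the global form.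
* `VectorBundleCore.continuousAt_totalSpace_map`, `VectorBundleCore.continuous_totalSpace_map` —
  both bundles given by cores: the local expression is
  `(b, x) ↦ g₂(indexAt (g b) → indexAt (g b₀)) (Φ_b (g₁(indexAt b₀ → indexAt b) x))`.
* **Morphisms of cores** (Husemoller Ch. 5 §3, induced bundles in terms of transition functions:
  if the charts of `Z₁` over `B₁` map into charts of `Z₂` over `B₂` along `f : B₁ → B₂`,
  `U¹ᵢ ⊆ f⁻¹ U²_{j i}`, and the cocycles agree, `g¹ᵢᵢ' = g²_{j i, j i'} ∘ f` on `U¹ᵢ ∩ U¹ᵢ'`, then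
  `Z₁ ≅ f* Z₂`): `VectorBundleCore.morphFiber` (the fibrewise isomorphisms, with inverse
  `morphFiberInv`, `morphFiberInv_morphFiber`, `morphFiber_morphFiberInv`), the continuity of the
  induced `f`-morphism of total spaces `continuous_morph`, and of its inverse realised on the
  pull-back bundle `continuous_morphInv_pullback`. The bundled isomorphism with the pull-back is
  assembled from these where bundled bundles are available (`ComplexVectorBundle.Iso`).

## References

* [HusemollerFibreBundles1994] D. Husemoller, *Fibre Bundles*, 3rd ed. (1994), Ch. 2 §5, Ch. 3 §2,
  Ch. 5 §2, §3 (transition functions of induced bundles).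
-/

noncomputable section

open Bundle Set Filter Topology

namespace Literature.AlgebraicTopology.CharacteristicClasses

section FiberBundle

variable {B₁ B₂ F₁ F₂ : Type*} [TopologicalSpace B₁] [TopologicalSpace B₂] [TopologicalSpace F₁]
  [TopologicalSpace F₂] {E₁ : B₁ → Type*} {E₂ : B₂ → Type*}
  [TopologicalSpace (TotalSpace F₁ E₁)] [TopologicalSpace (TotalSpace F₂ E₂)]
  [∀ b, TopologicalSpace (E₁ b)] [∀ b, TopologicalSpace (E₂ b)] [FiberBundle F₁ E₁]
  [FiberBundle F₂ E₂]

/-- **Continuity of a fibrewise map, read in trivialisations.** Let `Ψ ⟨b, v⟩ = ⟨g b, Φ_b v⟩` be a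
map of total spaces over a continuous `g : B₁ → B₂`, `p` a point of `E₁`, `e₁` the trivialisation
at `proj p` and `e₂` the one at `g (proj p)`. If the second component of `e₂ ∘ Ψ ∘ e₁⁻¹` is
continuous at `e₁ p`, then `Ψ` is continuous at `p` (Husemoller, Ch. 3 §2: a morphism is
continuous iff it is so in charts). [cite: HusemollerFibreBundles1994, Ch. 3 §2] -/
theorem continuousAt_totalSpace_map {g : B₁ → B₂} (hg : Continuous g)
    (Φ : ∀ b, E₁ b → E₂ (g b)) (p : TotalSpace F₁ E₁)
    (h : ContinuousAt (fun q : B₁ × F₁ ↦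
        (trivializationAt F₂ E₂ (g p.proj)
          ⟨g ((trivializationAt F₁ E₁ p.proj).toPartialEquiv.symm q).proj,
            Φ _ ((trivializationAt F₁ E₁ p.proj).toPartialEquiv.symm q).2⟩).2)
      (trivializationAt F₁ E₁ p.proj p)) :
    ContinuousAt (fun q : TotalSpace F₁ E₁ ↦ (⟨g q.proj, Φ q.proj q.2⟩ : TotalSpace F₂ E₂)) p := by
  set e₁ := trivializationAt F₁ E₁ p.proj with he₁
  set e₂ := trivializationAt F₂ E₂ (g p.proj) with he₂
  set Ψ : TotalSpace F₁ E₁ → TotalSpace F₂ E₂ := fun q ↦ ⟨g q.proj, Φ q.proj q.2⟩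
  have hp₁ : p.proj ∈ e₁.baseSet := mem_baseSet_trivializationAt F₁ E₁ p.proj
  have hp₂ : g p.proj ∈ e₂.baseSet := mem_baseSet_trivializationAt F₂ E₂ (g p.proj)
  refine e₂.continuousAt_of_comp_left
    ((hg.comp (FiberBundle.continuous_proj F₁ E₁)).continuousAt) hp₂ ?_
  refine e₁.continuousAt_of_comp_right hp₁ ?_
  have hev : ∀ᶠ q in 𝓝 (e₁ p), q ∈ e₁.target ∧ g q.1 ∈ e₂.baseSet := by
    refine Filter.inter_mem (e₁.open_target.mem_nhds (e₁.map_source (e₁.mem_source.2 hp₁))) ?_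
    refine ((hg.comp continuous_fst).continuousAt (x := e₁ p)).preimage_mem_nhds
      (e₂.open_baseSet.mem_nhds ?_)
    change g (e₁ p).1 ∈ e₂.baseSet
    rwa [e₁.coe_fst (e₁.mem_source.2 hp₁)]
  refine (((hg.comp continuous_fst).continuousAt (x := e₁ p)).prodMk h).congr_of_eventuallyEq ?_
  filter_upwards [hev] with q hq
  obtain ⟨hq₁, hq₂⟩ := hq
  have hr : (e₁.toPartialEquiv.symm q).proj = q.1 := e₁.proj_symm_apply hq₁
  refine Prod.ext ?_ rfl
  change (e₂ (Ψ (e₁.toPartialEquiv.symm q))).1 = g q.1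
  rw [e₂.coe_fst (e₂.mem_source.2 (by change g (e₁.toPartialEquiv.symm q).proj ∈ _; rwa [hr]))]
  change g (e₁.toPartialEquiv.symm q).proj = g q.1
  rw [hr]

/-- **Continuity of a fibrewise map, read in trivialisations** (global form of
`continuousAt_totalSpace_map`). [cite: HusemollerFibreBundles1994, Ch. 3 §2] -/
theorem continuous_totalSpace_map {g : B₁ → B₂} (hg : Continuous g)
    (Φ : ∀ b, E₁ b → E₂ (g b))
    (h : ∀ p : TotalSpace F₁ E₁, ContinuousAt (fun q : B₁ × F₁ ↦
        (trivializationAt F₂ E₂ (g p.proj)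
          ⟨g ((trivializationAt F₁ E₁ p.proj).toPartialEquiv.symm q).proj,
            Φ _ ((trivializationAt F₁ E₁ p.proj).toPartialEquiv.symm q).2⟩).2)
      (trivializationAt F₁ E₁ p.proj p)) :
    Continuous (fun q : TotalSpace F₁ E₁ ↦ (⟨g q.proj, Φ q.proj q.2⟩ : TotalSpace F₂ E₂)) :=
  continuous_iff_continuousAt.2 fun p ↦ continuousAt_totalSpace_map hg Φ p (h p)

end FiberBundle

section VectorBundleCore

variable {𝕜 : Type*} [NontriviallyNormedField 𝕜] {B₁ B₂ F₁ F₂ : Type*} [TopologicalSpace B₁]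
  [TopologicalSpace B₂] [NormedAddCommGroup F₁] [NormedSpace 𝕜 F₁] [NormedAddCommGroup F₂]
  [NormedSpace 𝕜 F₂] {ι₁ ι₂ : Type*}

/-- **Continuity of a fibrewise map between bundles presented by cores.** For
`Z₁ : VectorBundleCore 𝕜 B₁ F₁ ι₁`, `Z₂ : VectorBundleCore 𝕜 B₂ F₂ ι₂`, a continuous `g : B₁ → B₂`
and fibre maps `Φ_b : F₁ → F₂` (the fibres of a core are the model fibre, read in the chart
`indexAt`), the map `⟨b, v⟩ ↦ ⟨g b, Φ_b v⟩` of total spaces is continuous at `⟨b₀, v⟩` as soon as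
`(b, x) ↦ g₂[indexAt (g b) → indexAt (g b₀)](g b) (Φ_b (g₁[indexAt b₀ → indexAt b](b) x))` is
continuous at `(b₀, v)` — the local expression of the map in the distinguished charts at `b₀` and
`g b₀` (Husemoller, Ch. 5 §2: "locally `u` has the form `(b, x) ↦ (b, u_b(x))`"). A deliberate
dot-notation extension of Mathlib's `VectorBundleCore`. [cite: HusemollerFibreBundles1994, Ch. 5 §2] -/
theorem _root_.VectorBundleCore.continuousAt_totalSpace_map (Z₁ : VectorBundleCore 𝕜 B₁ F₁ ι₁)
    (Z₂ : VectorBundleCore 𝕜 B₂ F₂ ι₂) {g : B₁ → B₂} (hg : Continuous g)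
    (Φ : ∀ b, Z₁.Fiber b → Z₂.Fiber (g b)) (b₀ : B₁) (v : Z₁.Fiber b₀)
    (h : ContinuousAt (fun q : B₁ × F₁ ↦
        Z₂.coordChange (Z₂.indexAt (g q.1)) (Z₂.indexAt (g b₀)) (g q.1)
          (Φ q.1 (Z₁.coordChange (Z₁.indexAt b₀) (Z₁.indexAt q.1) q.1 q.2))) (b₀, v)) :
    ContinuousAt (fun q : Z₁.TotalSpace ↦ (⟨g q.proj, Φ q.proj q.2⟩ : Z₂.TotalSpace)) ⟨b₀, v⟩ := by
  refine Literature.AlgebraicTopology.CharacteristicClasses.continuousAt_totalSpace_map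
    (F₁ := F₁) (F₂ := F₂) hg Φ ⟨b₀, v⟩ ?_
  rw [Z₁.trivializationAt, Z₁.localTrivAt_apply_mk b₀ v]
  exact h

/-- **Continuity of a fibrewise map between bundles presented by cores** (global form of
`VectorBundleCore.continuousAt_totalSpace_map`; a deliberate dot-notation extension of Mathlib's
`VectorBundleCore`). [cite: HusemollerFibreBundles1994, Ch. 5 §2] -/
theorem _root_.VectorBundleCore.continuous_totalSpace_map (Z₁ : VectorBundleCore 𝕜 B₁ F₁ ι₁)
    (Z₂ : VectorBundleCore 𝕜 B₂ F₂ ι₂) {g : B₁ → B₂} (hg : Continuous g)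
    (Φ : ∀ b, Z₁.Fiber b → Z₂.Fiber (g b))
    (h : ∀ (b₀ : B₁) (v : F₁), ContinuousAt (fun q : B₁ × F₁ ↦
        Z₂.coordChange (Z₂.indexAt (g q.1)) (Z₂.indexAt (g b₀)) (g q.1)
          (Φ q.1 (Z₁.coordChange (Z₁.indexAt b₀) (Z₁.indexAt q.1) q.1 q.2))) (b₀, v)) :
    Continuous (fun q : Z₁.TotalSpace ↦ (⟨g q.proj, Φ q.proj q.2⟩ : Z₂.TotalSpace)) :=
  continuous_iff_continuousAt.2 fun p ↦ Z₁.continuousAt_totalSpace_map Z₂ hg Φ p.proj p.2 (h _ _)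

end VectorBundleCore


/-! ### Morphisms of cores and the isomorphism with the pull-back -/

section CoreMorphism

variable {𝕜 : Type*} [NontriviallyNormedField 𝕜] {B₁ B₂ F : Type*} [TopologicalSpace B₁]
  [TopologicalSpace B₂] [NormedAddCommGroup F] [NormedSpace 𝕜 F] {ι₁ ι₂ : Type*}
  (Z₁ : VectorBundleCore 𝕜 B₁ F ι₁) (Z₂ : VectorBundleCore 𝕜 B₂ F ι₂) (f : B₁ → B₂) (j : ι₁ → ι₂)

/-- The **fibre maps of a morphism of cores** `(f, j) : Z₁ → Z₂`: a vector of `Z₁` at `b`, read in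
the distinguished chart `indexAt b` — which the morphism identifies with the chart `j (indexAt b)`
of `Z₂` at `f b` — is re-read in the distinguished chart `indexAt (f b)` of `Z₂` (Husemoller,
Ch. 5 §3: induced bundles and transition functions). Typed on the model fibre `F` (the fibres of
a core are `F` by definition). A deliberate dot-notation extension of Mathlib's
`VectorBundleCore`. [cite: HusemollerFibreBundles1994, Ch. 5 §3] -/
def _root_.VectorBundleCore.morphFiber (b : B₁) : F →L[𝕜] F :=
  Z₂.coordChange (j (Z₁.indexAt b)) (Z₂.indexAt (f b)) (f b)

/-- The inverse fibre maps of a morphism of cores (`morphFiber`). A deliberate dot-notation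
extension of Mathlib's `VectorBundleCore`. [cite: HusemollerFibreBundles1994, Ch. 5 §3] -/
def _root_.VectorBundleCore.morphFiberInv (b : B₁) : F →L[𝕜] F :=
  Z₂.coordChange (Z₂.indexAt (f b)) (j (Z₁.indexAt b)) (f b)

variable {Z₁ Z₂ f j}

/-- `morphFiberInv ∘ morphFiber = id` when the charts are compatible (`U¹ᵢ ⊆ f⁻¹ U²_{j i}`).
[cite: HusemollerFibreBundles1994, Ch. 5 §3] -/
theorem _root_.VectorBundleCore.morphFiberInv_morphFiber
    (hbase : ∀ i, Z₁.baseSet i ⊆ f ⁻¹' Z₂.baseSet (j i)) (b : B₁) (v : F) :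
    Z₁.morphFiberInv Z₂ f j b (Z₁.morphFiber Z₂ f j b v) = v := by
  have h₁ : f b ∈ Z₂.baseSet (j (Z₁.indexAt b)) := hbase _ (Z₁.mem_baseSet_at b)
  have h₂ : f b ∈ Z₂.baseSet (Z₂.indexAt (f b)) := Z₂.mem_baseSet_at (f b)
  rw [VectorBundleCore.morphFiberInv, VectorBundleCore.morphFiber,
    Z₂.coordChange_comp _ _ _ _ ⟨⟨h₁, h₂⟩, h₁⟩, Z₂.coordChange_self _ _ h₁]

/-- `morphFiber ∘ morphFiberInv = id` when the charts are compatible.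
[cite: HusemollerFibreBundles1994, Ch. 5 §3] -/
theorem _root_.VectorBundleCore.morphFiber_morphFiberInv
    (hbase : ∀ i, Z₁.baseSet i ⊆ f ⁻¹' Z₂.baseSet (j i)) (b : B₁) (w : F) :
    Z₁.morphFiber Z₂ f j b (Z₁.morphFiberInv Z₂ f j b w) = w := by
  have h₁ : f b ∈ Z₂.baseSet (j (Z₁.indexAt b)) := hbase _ (Z₁.mem_baseSet_at b)
  have h₂ : f b ∈ Z₂.baseSet (Z₂.indexAt (f b)) := Z₂.mem_baseSet_at (f b)
  rw [VectorBundleCore.morphFiberInv, VectorBundleCore.morphFiber,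
    Z₂.coordChange_comp _ _ _ _ ⟨⟨h₂, h₁⟩, h₂⟩, Z₂.coordChange_self _ _ h₂]

/-- The fibrewise **continuous linear equivalences of a morphism of cores** with compatible charts
(`morphFiber` with inverse `morphFiberInv`). A deliberate dot-notation extension of Mathlib's
`VectorBundleCore`. [cite: HusemollerFibreBundles1994, Ch. 5 §3] -/
def _root_.VectorBundleCore.morphEquiv (hbase : ∀ i, Z₁.baseSet i ⊆ f ⁻¹' Z₂.baseSet (j i))
    (b : B₁) : F ≃L[𝕜] F :=
  ContinuousLinearEquiv.equivOfInverse (Z₁.morphFiber Z₂ f j b) (Z₁.morphFiberInv Z₂ f j b)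
    (Z₁.morphFiberInv_morphFiber hbase b) (Z₁.morphFiber_morphFiberInv hbase b)

/-- `morphEquiv` is `morphFiber`. [cite: HusemollerFibreBundles1994, Ch. 5 §3] -/
@[simp]
theorem _root_.VectorBundleCore.morphEquiv_apply
    (hbase : ∀ i, Z₁.baseSet i ⊆ f ⁻¹' Z₂.baseSet (j i)) (b : B₁) (v : F) :
    Z₁.morphEquiv hbase b v = Z₁.morphFiber Z₂ f j b v := rfl

/-- The inverse of `morphEquiv` is `morphFiberInv`. [cite: HusemollerFibreBundles1994, Ch. 5 §3] -/
@[simp]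
theorem _root_.VectorBundleCore.morphEquiv_symm_apply
    (hbase : ∀ i, Z₁.baseSet i ⊆ f ⁻¹' Z₂.baseSet (j i)) (b : B₁) (w : F) :
    (Z₁.morphEquiv hbase b).symm w = Z₁.morphFiberInv Z₂ f j b w := rfl

/-- **A morphism of cores induces a continuous `f`-morphism of total spaces**
`⟨b, v⟩ ↦ ⟨f b, morphFiber b v⟩`, provided the charts are compatible (`U¹ᵢ ⊆ f⁻¹ U²_{j i}`) and
the cocycles agree (`g¹ᵢᵢ'(b) = g²_{j i, j i'}(f b)` on `U¹ᵢ ∩ U¹ᵢ'`): in the distinguished charts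
at `b₀` and `f b₀` the map is `(b, x) ↦ g²_{j (indexAt b₀), indexAt (f b₀)}(f b) x`
(Husemoller, Ch. 5 §3). [cite: HusemollerFibreBundles1994, Ch. 5 §3] -/
theorem _root_.VectorBundleCore.continuous_morph (hf : Continuous f)
    (hbase : ∀ i, Z₁.baseSet i ⊆ f ⁻¹' Z₂.baseSet (j i))
    (hcoord : ∀ i i' b, b ∈ Z₁.baseSet i ∩ Z₁.baseSet i' → ∀ v,
      Z₁.coordChange i i' b v = Z₂.coordChange (j i) (j i') (f b) v) :
    Continuous fun q : Z₁.TotalSpace ↦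
      (⟨f q.proj, Z₁.morphFiber Z₂ f j q.proj q.2⟩ : Z₂.TotalSpace) := by
  refine Z₁.continuous_totalSpace_map Z₂ hf (fun b v ↦ Z₁.morphFiber Z₂ f j b v) fun b₀ v ↦ ?_
  have hN : ∀ᶠ q : B₁ × F in 𝓝 (b₀, v),
      q.1 ∈ Z₁.baseSet (Z₁.indexAt b₀) ∧ f q.1 ∈ Z₂.baseSet (Z₂.indexAt (f b₀)) := by
    exact (continuousAt_fst (p := (b₀, v))).preimage_mem_nhds
      (Filter.inter_mem ((Z₁.isOpen_baseSet _).mem_nhds (Z₁.mem_baseSet_at b₀))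
        (hf.continuousAt.preimage_mem_nhds ((Z₂.isOpen_baseSet _).mem_nhds (Z₂.mem_baseSet_at _))))
  have hA : ContinuousAt
      (fun b ↦ Z₂.coordChange (j (Z₁.indexAt b₀)) (Z₂.indexAt (f b₀)) (f b)) b₀ := by
    refine ((Z₂.continuousOn_coordChange _ _).comp hf.continuousOn fun b hb ↦ hb).continuousAt ?_
    exact Filter.inter_mem
      (hf.continuousAt.preimage_mem_nhds ((Z₂.isOpen_baseSet _).mem_nhds
        (hbase _ (Z₁.mem_baseSet_at b₀))))
      (hf.continuousAt.preimage_mem_nhds ((Z₂.isOpen_baseSet _).mem_nhds (Z₂.mem_baseSet_at _)))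
  refine ((hA.comp continuousAt_fst).clm_apply continuousAt_snd).congr_of_eventuallyEq ?_
  filter_upwards [hN] with q hq
  obtain ⟨hq₁, hq₂⟩ := hq
  have hb : q.1 ∈ Z₁.baseSet (Z₁.indexAt q.1) := Z₁.mem_baseSet_at q.1
  have h₀ : f q.1 ∈ Z₂.baseSet (j (Z₁.indexAt b₀)) := hbase _ hq₁
  have h₁ : f q.1 ∈ Z₂.baseSet (j (Z₁.indexAt q.1)) := hbase _ hb
  have h₂ : f q.1 ∈ Z₂.baseSet (Z₂.indexAt (f q.1)) := Z₂.mem_baseSet_at _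
  rw [hcoord _ _ _ ⟨hq₁, hb⟩, VectorBundleCore.morphFiber,
    Z₂.coordChange_comp _ _ _ _ ⟨⟨h₀, h₁⟩, h₂⟩, Z₂.coordChange_comp _ _ _ _ ⟨⟨h₀, h₂⟩, hq₂⟩]
  rfl

/-- **The inverse of the morphism of cores, on the pull-back, is continuous**: for `f` continuous
(bundled, so that Mathlib's pull-back bundle `f *ᵖ Z₂` is available) and compatible charts and
cocycles, `⟨b, w⟩ ↦ ⟨b, morphFiberInv b w⟩ : f *ᵖ Z₂ → Z₁` is continuous — in the charts at `b₀`
it is `(b, x) ↦ g²_{indexAt (f b₀), j (indexAt b₀)}(f b) x` (Husemoller, Ch. 5 §3: `Z₁ ≅ f* Z₂`).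
[cite: HusemollerFibreBundles1994, Ch. 5 §3] -/
theorem _root_.VectorBundleCore.continuous_morphInv_pullback (f : C(B₁, B₂))
    (hbase : ∀ i, Z₁.baseSet i ⊆ f ⁻¹' Z₂.baseSet (j i))
    (hcoord : ∀ i i' b, b ∈ Z₁.baseSet i ∩ Z₁.baseSet i' → ∀ v,
      Z₁.coordChange i i' b v = Z₂.coordChange (j i) (j i') (f b) v) :
    Continuous fun q : TotalSpace F ((f : B₁ → B₂) *ᵖ Z₂.Fiber) ↦
      (⟨q.proj, Z₁.morphFiberInv Z₂ f j q.proj q.2⟩ : Z₁.TotalSpace) := by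
  have hf : Continuous f := f.continuous
  refine continuous_totalSpace_map (F₁ := F) (F₂ := F) (E₁ := (f : B₁ → B₂) *ᵖ Z₂.Fiber)
    (E₂ := Z₁.Fiber) continuous_id (fun b w ↦ Z₁.morphFiberInv Z₂ f j b w) fun p ↦ ?_
  obtain ⟨b₀, w⟩ := p
  change F at w
  -- the point at which continuity is required, and the local expression
  have hpt : trivializationAt F ((f : B₁ → B₂) *ᵖ Z₂.Fiber) b₀ ⟨b₀, w⟩ = (b₀, w) := by
    change (b₀, (Z₂.localTrivAt (f b₀) ⟨f b₀, w⟩).2) = (b₀, w)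
    simp only [Z₂.localTrivAt_apply_mk]
  rw [hpt]
  change ContinuousAt (fun q : B₁ × F ↦ Z₁.coordChange (Z₁.indexAt q.1) (Z₁.indexAt b₀) q.1
    (Z₁.morphFiberInv Z₂ f j q.1 ((Z₂.localTrivAt (f b₀)).symm (f q.1) q.2))) (b₀, w)
  have hN : ∀ᶠ q : B₁ × F in 𝓝 (b₀, w),
      q.1 ∈ Z₁.baseSet (Z₁.indexAt b₀) ∧ f q.1 ∈ Z₂.baseSet (Z₂.indexAt (f b₀)) := by
    exact (continuousAt_fst (p := (b₀, w))).preimage_mem_nhds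
      (Filter.inter_mem ((Z₁.isOpen_baseSet _).mem_nhds (Z₁.mem_baseSet_at b₀))
        (hf.continuousAt.preimage_mem_nhds ((Z₂.isOpen_baseSet _).mem_nhds (Z₂.mem_baseSet_at _))))
  have hA : ContinuousAt
      (fun b ↦ Z₂.coordChange (Z₂.indexAt (f b₀)) (j (Z₁.indexAt b₀)) (f b)) b₀ := by
    refine ((Z₂.continuousOn_coordChange _ _).comp hf.continuousOn fun b hb ↦ hb).continuousAt ?_
    exact Filter.inter_mem
      (hf.continuousAt.preimage_mem_nhds ((Z₂.isOpen_baseSet _).mem_nhds (Z₂.mem_baseSet_at _)))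
      (hf.continuousAt.preimage_mem_nhds ((Z₂.isOpen_baseSet _).mem_nhds
        (hbase _ (Z₁.mem_baseSet_at b₀))))
  refine ((hA.comp continuousAt_fst).clm_apply continuousAt_snd).congr_of_eventuallyEq ?_
  filter_upwards [hN] with q hq
  obtain ⟨hq₁, hq₂⟩ := hq
  have hb : q.1 ∈ Z₁.baseSet (Z₁.indexAt q.1) := Z₁.mem_baseSet_at q.1
  have h₀ : f q.1 ∈ Z₂.baseSet (j (Z₁.indexAt b₀)) := hbase _ hq₁
  have h₁ : f q.1 ∈ Z₂.baseSet (j (Z₁.indexAt q.1)) := hbase _ hb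
  have h₂ : f q.1 ∈ Z₂.baseSet (Z₂.indexAt (f q.1)) := Z₂.mem_baseSet_at _
  rw [VectorBundleCore.localTrivAt, Z₂.localTriv_symm_apply _ hq₂, hcoord _ _ _ ⟨hb, hq₁⟩,
    VectorBundleCore.morphFiberInv, Z₂.coordChange_comp _ _ _ _ ⟨⟨hq₂, h₂⟩, h₁⟩,
    Z₂.coordChange_comp _ _ _ _ ⟨⟨hq₂, h₁⟩, h₀⟩]
  rfl

end CoreMorphism

end Literature.AlgebraicTopology.CharacteristicClasses
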